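import Literature.MathematicalPhysics.QuantumLattice.HubbardCovarianceFrameResolvent
import Literature.MathematicalPhysics.QuantumLattice.HubbardScaleReportCT
import Mathlib.Analysis.Complex.RealDeriv
import Mathlib.Analysis.SpecialFunctions.Log.Deriv
import Mathlib.Analysis.SpecialFunctions.ExpDeriv
import HarnessLib

/-!
# The Gaussian normalisation of a counterterm frame: `‖∫ dμ_{C^K} e^{−𝒩_K}‖ = N^0 / N^K`

Topic `Literature/MathematicalPhysics/QuantumLattice`; completes `HubbardCovarianceFrameResolvent.lean`.  There the frame `K` of the
seeded Hubbard torus (renormalised band `e_K = ξ − K`, vertex `V + 𝒩_K`) was shown to be a change of Gaussian measure,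
`∫ dμ_{C^K} e^{−(V+𝒩_K)} = Z_K · ∫ dμ_C e^{−V}` with `Z_K = ∫ dμ_{C^K} e^{−𝒩_K}` and `Z_K² · det(1 − C^0 S_K) = 1`.  Here the determinant
is computed in closed form:

  `det(1 − C^0 S_K) = Π_k (den_K(k) / den_0(k))²`,   `den_K(k) = ω_k² + e_K(k⃗)² + h²φ_d(k⃗)²`

(`det_one_sub_counterMatrix_eq_prod`), hence `‖Z_K‖ = Π_k den_0(k)/den_K(k) = N^0/N^K` (`norm_gaussExpect_counterQuadratic`; in
particular `Z_K ≠ 0`) and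

  `freeLogDetCT … K 0 + log ‖Z_K‖ = freeLogDetCT … 0 0`            (`freeLogDetCT_add_log_norm_gaussExpect_counterQuadratic`)
  `N^K · ‖∫ dμ_{C^K} e^{−V_K}‖ = N^0 · ‖∫ dμ_C e^{−V}‖`               (`prod_nambuDenCT_mul_norm_effPartitionFn_hubbardInteractionCT`)

for every frame `K`, every `U, μ, h`, `β ≠ 0`, at finite `(L, M)`: the free determinant of the frame and the Gaussian normalisation
of its counterterm cancel EXACTLY, so "free log-determinant + log of the normalised partition function" — the combination entering
`mfFreeEnergyCT` — is the same number in every frame once the whole covariance is integrated (zero twist).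

Method (no Pfaffians, no block diagonalisation): along the scaled frames `K_t = t·K` the function
`G(t) = det(1 − t C^0 S_K)` satisfies `G′ = −tr(C^{K_t} S_K) · G` on `ℝ` — by the resolvent cocycle
`(1 − t C^0 S_K)(1 − s C^{K_t} S_K) = 1 − (t+s) C^0 S_K` (`one_sub_smul_mul_one_sub_smul`, from `(1 − C^0 S_{K_t}) C^{K_t} = C^0` of
`HubbardCovarianceFrameResolvent`) and Jacobi at the identity — while `tr(C^{K′} S_K) = 4 Σ_k K(p_k) e_{K′}(k)/den_{K′}(k)`
(`trace_hubbardCovarianceCT_mul_counterMatrix`: spins and charge orders double, the `iω` part is odd over the symmetric frequency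
set) is exactly `d/dt Σ_k 2(log den_0(k) − log den_{K_t}(k))`; so `G(t) · exp Σ_k 2(log den_0 − log den_{K_t})` is constant `= 1`
(`det_one_sub_smul_mul_exp`), and `t = 1` is the claim.

## Sources

J. Feldman, M. Salmhofer, E. Trubowitz, J. Stat. Phys. 84 (1996) 1209, §1–2 (the counterterm `K` as part of the interaction;
`E = e + K`) [`FeldmanSalmhoferTrubowitz1996`]; G. Benfatto, A. Giuliani, V. Mastropietro, Ann. Henri Poincaré 4 (2003) 137,
§1.2 (2.6)–(2.10) (`P(dψ)` with `ε = ε₀ − δε` and `e^{−𝒱−𝒩}`) [`BenfattoGiulianiMastropietro2003`]. The closed form is an exact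
finite-dimensional Gaussian computation. [folklore]
-/

noncomputable section

namespace Literature.MathematicalPhysics.QuantumLattice

open Literature.Probability.LatticeModels GrassmannAlgebra Finset Matrix

variable (L M : ℕ)

/-! ### §1 Scaled frames `K_t = t·K` -/

section ScaledFrame

/-- Evaluation is linear in the coefficient table: the frame with coefficients `t·κ_{m,n}` evaluates to `t·K(p)`. [folklore] -/
theorem TrigPolyC4v.eval_smul_coeff (K : TrigPolyC4v) (t : ℝ) (p : Fin 2 → ℝ) :
    TrigPolyC4v.eval ⟨K.degree, fun m n => t * K.coeff m n⟩ p = t * K.eval p := by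
  simp only [TrigPolyC4v.eval, Finset.mul_sum, mul_assoc]

/-- The scaled frame at `t = 1` is the frame. [folklore] -/
theorem TrigPolyC4v.smul_coeff_one (K : TrigPolyC4v) : (⟨K.degree, fun m n => 1 * K.coeff m n⟩ : TrigPolyC4v) = K := by
  ext <;> simp

/-- The renormalised band of the scaled frame: `e_{K_t} = ξ − t K`. [folklore] -/
theorem nambuXiCT_smul_coeff (μ : ℝ) (K : TrigPolyC4v) (t : ℝ) (k : TorusSite 2 L) :
    nambuXiCT L μ ⟨K.degree, fun m n => t * K.coeff m n⟩ k = nambuXi L μ k - t * K.eval (latticeMomentum L k) := by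
  rw [nambuXiCT, TrigPolyC4v.eval_smul_coeff, nambuXi]

variable [NeZero L] (β μ h : ℝ) (K : TrigPolyC4v)

omit [NeZero L] in
/-- The counterterm matrix is linear in the frame: `S_{K_t} = t · S_K`. [folklore] -/
theorem counterMatrix_smul_coeff (t : ℝ) :
    (Matrix.of fun Z W : HubbardFieldIdx L M =>
        (if Z.2 = 0 ∧ W = (Z.1, 1) then
            -(((TrigPolyC4v.eval ⟨K.degree, fun m n => t * K.coeff m n⟩ (latticeMomentum L Z.1.1.2) / (β * (L : ℝ) ^ 2) : ℝ) : ℂ))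
          else 0) -
        (if W.2 = 0 ∧ Z = (W.1, 1) then
            -(((TrigPolyC4v.eval ⟨K.degree, fun m n => t * K.coeff m n⟩ (latticeMomentum L W.1.1.2) / (β * (L : ℝ) ^ 2) : ℝ) : ℂ))
          else 0)) =
      (t : ℂ) • Matrix.of fun Z W : HubbardFieldIdx L M =>
        (if Z.2 = 0 ∧ W = (Z.1, 1) then -(((K.eval (latticeMomentum L Z.1.1.2) / (β * (L : ℝ) ^ 2) : ℝ) : ℂ)) else 0) -
        (if W.2 = 0 ∧ Z = (W.1, 1) then -(((K.eval (latticeMomentum L W.1.1.2) / (β * (L : ℝ) ^ 2) : ℝ) : ℂ)) else 0) := by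
  ext Z W
  simp only [Matrix.of_apply, Matrix.smul_apply, smul_eq_mul, TrigPolyC4v.eval_smul_coeff, mul_sub, mul_ite, mul_zero, mul_neg]
  congr 2 <;> push_cast <;> ring

/-- **The explicit inverse along the scaled frames**: `(1 − t·C^0 S_K)(1 + C^{K_t} S_{K_t}) = 1` (`β ≠ 0`). [folklore] -/
theorem one_sub_smul_mul_counterResolvent {β : ℝ} (hβ : β ≠ 0) (t : ℝ) :
    (1 - (t : ℂ) • (hubbardCovarianceCT L M β μ h 0 *
        Matrix.of fun Z W : HubbardFieldIdx L M =>
          (if Z.2 = 0 ∧ W = (Z.1, 1) then -(((K.eval (latticeMomentum L Z.1.1.2) / (β * (L : ℝ) ^ 2) : ℝ) : ℂ)) else 0) -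
          (if W.2 = 0 ∧ Z = (W.1, 1) then -(((K.eval (latticeMomentum L W.1.1.2) / (β * (L : ℝ) ^ 2) : ℝ) : ℂ)) else 0))) *
      (1 + hubbardCovarianceCT L M β μ h ⟨K.degree, fun m n => t * K.coeff m n⟩ *
        Matrix.of fun Z W : HubbardFieldIdx L M =>
          (if Z.2 = 0 ∧ W = (Z.1, 1) then
              -(((TrigPolyC4v.eval ⟨K.degree, fun m n => t * K.coeff m n⟩ (latticeMomentum L Z.1.1.2) / (β * (L : ℝ) ^ 2) : ℝ) : ℂ))
            else 0) -
          (if W.2 = 0 ∧ Z = (W.1, 1) then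
              -(((TrigPolyC4v.eval ⟨K.degree, fun m n => t * K.coeff m n⟩ (latticeMomentum L W.1.1.2) / (β * (L : ℝ) ^ 2) : ℝ) : ℂ))
            else 0)) = 1 := by
  have h1 := counterResolvent_mul' L M μ h (⟨K.degree, fun m n => t * K.coeff m n⟩ : TrigPolyC4v) hβ
  rw [counterMatrix_smul_coeff L M β K t, Matrix.mul_smul] at h1
  rw [counterMatrix_smul_coeff L M β K t]
  exact h1

end ScaledFrame

/-! ### §2 The trace of `C^{K′} S_K`: `4 Σ_k K(p_k) e_{K′}(k)/den_{K′}(k)` -/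

section Trace

variable {L M} [NeZero L] (β μ h : ℝ) (K K' : TrigPolyC4v)

/-- The BCS denominator is even under `k ↦ -k` (frequency and momentum reflected). [folklore] -/
theorem nambuDenCT_neg (k : FreqMomentum L M) : nambuDenCT L M β μ h K' k.neg = nambuDenCT L M β μ h K' k := by
  simp only [nambuDenCT, FreqMomentum.neg, matsubaraFreq_rev, neg_sq, nambuXiCT_neg, dWaveSymbol_neg]

/-- A sum of an odd function over `FreqMomentum` vanishes. [folklore] -/
theorem sum_eq_zero_of_neg {f : FreqMomentum L M → ℂ} (hf : ∀ k, f k.neg = -f k) : ∑ k, f k = 0 := by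
  have h := Equiv.sum_comp (Function.Involutive.toPerm _ FreqMomentum.neg_involutive) f
  simp only [Function.Involutive.coe_toPerm, hf, Finset.sum_neg_distrib] at h
  linear_combination -(h / 2)

/-- **The normal diagonal of `C^{K′}`**: `C^{K′}((k,σ,ψ̂⁺),(k,σ,ψ̂⁻)) = βL² (iω + e_{K′}(k))/den_{K′}(k)` for both spins (the spin-`↓`
entry is read at `-k` in Nambu labels, where `ω ↦ -ω`). [folklore] -/
theorem hubbardCovarianceCT_plus_minus (k : FreqMomentum L M) (σ : Fin 2) :
    hubbardCovarianceCT L M β μ h K' ((k, σ), 0) ((k, σ), 1) =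
      ((β * (L : ℝ) ^ 2 : ℝ) : ℂ) * ((Complex.I * matsubaraFreq β M k.1 + nambuXiCT L μ K' k.2) / nambuDenCT L M β μ h K' k) := by
  fin_cases σ
  · simp only [Fin.zero_eta, Fin.isValue, hubbardCovarianceCT_apply, toNambu_up, nambuAnti_zero_one, if_true, neg_neg]
    simp [nambuPropagatorCT]
  · simp only [Fin.mk_one, Fin.isValue, hubbardCovarianceCT_apply, toNambu_down_plus, toNambu_down_minus, nambuAnti_one_zero,
      if_true]
    have hω : matsubaraFreq β M k.neg.1 = -matsubaraFreq β M k.1 := matsubaraFreq_rev β k.1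
    have he : nambuXiCT L μ K' k.neg.2 = nambuXiCT L μ K' k.2 := nambuXiCT_neg L μ K' k.2
    simp only [nambuPropagatorCT, Matrix.cons_val', Matrix.cons_val_one, Matrix.cons_val_fin_one, Matrix.empty_val',
      Matrix.of_apply, hω, he, nambuDenCT_neg]
    push_cast
    ring

/-- **The trace of the frame covariance against the counterterm**: `tr(C^{K′} S_K) = 4 Σ_k K(p_k) e_{K′}(k)/den_{K′}(k)` — the spins
double, the charge orders double, `(K/(βL²))·βL² = K`, and the `iω` part cancels over the symmetric frequency set. [folklore] -/
theorem trace_hubbardCovarianceCT_mul_counterMatrix {β : ℝ} (hβ : β ≠ 0) :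
    Matrix.trace (hubbardCovarianceCT L M β μ h K' *
        Matrix.of fun Z W : HubbardFieldIdx L M =>
          (if Z.2 = 0 ∧ W = (Z.1, 1) then -(((K.eval (latticeMomentum L Z.1.1.2) / (β * (L : ℝ) ^ 2) : ℝ) : ℂ)) else 0) -
          (if W.2 = 0 ∧ Z = (W.1, 1) then -(((K.eval (latticeMomentum L W.1.1.2) / (β * (L : ℝ) ^ 2) : ℝ) : ℂ)) else 0)) =
      4 * ∑ k : FreqMomentum L M,
        (K.eval (latticeMomentum L k.2) : ℂ) * (nambuXiCT L μ K' k.2 : ℂ) / (nambuDenCT L M β μ h K' k : ℂ) := by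
  have hL : (L : ℝ) ≠ 0 := Nat.cast_ne_zero.2 (NeZero.ne L)
  have hB : ((β * (L : ℝ) ^ 2 : ℝ) : ℂ) ≠ 0 := by exact_mod_cast mul_ne_zero hβ (pow_ne_zero 2 hL)
  set C := hubbardCovarianceCT L M β μ h K' with hCdef
  -- the trace through the contraction lemma with `Q = 1`
  have htr : Matrix.trace (C * Matrix.of fun Z W : HubbardFieldIdx L M =>
      (if Z.2 = 0 ∧ W = (Z.1, 1) then -(((K.eval (latticeMomentum L Z.1.1.2) / (β * (L : ℝ) ^ 2) : ℝ) : ℂ)) else 0) -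
        (if W.2 = 0 ∧ Z = (W.1, 1) then -(((K.eval (latticeMomentum L W.1.1.2) / (β * (L : ℝ) ^ 2) : ℝ) : ℂ)) else 0)) =
      ∑ Z₁ : FreqMomentum L M × Fin 2, (((K.eval (latticeMomentum L Z₁.1.2) / (β * (L : ℝ) ^ 2) : ℝ) : ℂ)) *
        (2 * C (Z₁, 0) (Z₁, 1)) := by
    have h1 : ∀ X : HubbardFieldIdx L M, (C * Matrix.of fun Z W : HubbardFieldIdx L M =>
        (if Z.2 = 0 ∧ W = (Z.1, 1) then -(((K.eval (latticeMomentum L Z.1.1.2) / (β * (L : ℝ) ^ 2) : ℝ) : ℂ)) else 0) -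
          (if W.2 = 0 ∧ Z = (W.1, 1) then -(((K.eval (latticeMomentum L W.1.1.2) / (β * (L : ℝ) ^ 2) : ℝ) : ℂ)) else 0)) X X =
        ∑ Z₁ : FreqMomentum L M × Fin 2, (((K.eval (latticeMomentum L Z₁.1.2) / (β * (L : ℝ) ^ 2) : ℝ) : ℂ)) *
          (C X (Z₁, 1) * (1 : Matrix (HubbardFieldIdx L M) (HubbardFieldIdx L M) ℂ) (Z₁, 0) X -
            C X (Z₁, 0) * (1 : Matrix (HubbardFieldIdx L M) (HubbardFieldIdx L M) ℂ) (Z₁, 1) X) := by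
      intro X
      have hA := mul_counterMatrix_mul_apply C 1
        (fun Z₁ : FreqMomentum L M × Fin 2 => (((K.eval (latticeMomentum L Z₁.1.2) / (β * (L : ℝ) ^ 2) : ℝ) : ℂ))) X X
      rw [Matrix.mul_one] at hA
      exact hA
    simp only [Matrix.trace, Matrix.diag, h1]
    rw [Finset.sum_comm]
    refine Finset.sum_congr rfl fun Z₁ _ => ?_
    rw [← Finset.mul_sum]
    congr 1
    simp only [Matrix.one_apply, mul_ite, mul_one, mul_zero, Finset.sum_sub_distrib, Finset.sum_ite_eq, Finset.mem_univ,
      if_true]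
    have hanti : C (Z₁, 1) (Z₁, 0) = -C (Z₁, 0) (Z₁, 1) := by
      rw [← Matrix.transpose_apply C (Z₁, 0) (Z₁, 1), hCdef, hubbardCovarianceCT_transpose, Matrix.neg_apply]
    rw [hanti]
    ring
  rw [htr, Fintype.sum_prod_type, Finset.mul_sum]
  simp only [Fin.sum_univ_two, Fin.isValue, hCdef, hubbardCovarianceCT_plus_minus]
  -- the `iω` part is odd under `k ↦ -k`
  have hodd : ∑ k : FreqMomentum L M, (K.eval (latticeMomentum L k.2) : ℂ) * (Complex.I * matsubaraFreq β M k.1) /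
      (nambuDenCT L M β μ h K' k : ℂ) = 0 := by
    refine sum_eq_zero_of_neg fun k => ?_
    rw [nambuDenCT_neg, show k.neg.2 = -k.2 from rfl, TrigPolyC4v.eval_latticeMomentum_neg,
      show k.neg.1 = k.1.rev from rfl, matsubaraFreq_rev]
    push_cast
    ring
  have hsplit : ∀ k : FreqMomentum L M,
      (((K.eval (latticeMomentum L k.2) / (β * (L : ℝ) ^ 2) : ℝ) : ℂ)) *
          (2 * (((β * (L : ℝ) ^ 2 : ℝ) : ℂ) * ((Complex.I * matsubaraFreq β M k.1 + nambuXiCT L μ K' k.2) / nambuDenCT L M β μ h K' k))) +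
        (((K.eval (latticeMomentum L k.2) / (β * (L : ℝ) ^ 2) : ℝ) : ℂ)) *
          (2 * (((β * (L : ℝ) ^ 2 : ℝ) : ℂ) * ((Complex.I * matsubaraFreq β M k.1 + nambuXiCT L μ K' k.2) / nambuDenCT L M β μ h K' k))) =
      4 * ((K.eval (latticeMomentum L k.2) : ℂ) * (nambuXiCT L μ K' k.2 : ℂ) / (nambuDenCT L M β μ h K' k : ℂ)) +
        4 * ((K.eval (latticeMomentum L k.2) : ℂ) * (Complex.I * matsubaraFreq β M k.1) / (nambuDenCT L M β μ h K' k : ℂ)) := by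
    intro k
    rw [Complex.ofReal_div]
    field_simp
    ring
  simp only [hsplit, Finset.sum_add_distrib, ← Finset.mul_sum, hodd, mul_zero, add_zero]

end Trace

/-! ### §3 The flow along the scaled frames: `det(1 − C^0 S_K) = Π_k (den_K/den_0)²` -/

/-- **Jacobi at the identity for complex matrices along a real parameter**: `d/ds det(1 − s·A)|₀ = −tr A` (from the
complex-parameter `hasDerivAt_det_one_sub_smul_zero` of `GrassmannGaussianQuadraticNormalisation`). [folklore] -/
theorem hasDerivAt_det_one_sub_ofReal_smul {n : Type*} [Fintype n] [DecidableEq n] (A : Matrix n n ℂ) :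
    HasDerivAt (fun s : ℝ => (1 - (s : ℂ) • A).det) (-A.trace) 0 := by
  have h := hasDerivAt_det_one_sub_smul_zero A
  rw [← Complex.ofReal_zero] at h
  exact h.comp_ofReal

section FreeModes

variable {L M} (β μ h : ℝ) (K : TrigPolyC4v)

/-- The BCS denominator along the scaled frames `K_t = t·K`: `den_{K_t}(k) = ω² + (ξ − tK(p))² + h²φ_d²`. [folklore] -/
theorem nambuDenCT_smul_coeff (t : ℝ) (k : FreqMomentum L M) :
    nambuDenCT L M β μ h ⟨K.degree, fun m n => t * K.coeff m n⟩ k =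
      matsubaraFreq β M k.1 ^ 2 + (nambuXi L μ k.2 - t * K.eval (latticeMomentum L k.2)) ^ 2 + (h * dWaveSymbol L k.2) ^ 2 := by
  rw [nambuDenCT, nambuXiCT_smul_coeff]

/-- At `t = 0` the scaled frame has the bare denominator. [folklore] -/
theorem nambuDenCT_smul_coeff_zero (k : FreqMomentum L M) :
    nambuDenCT L M β μ h ⟨K.degree, fun m n => (0 : ℝ) * K.coeff m n⟩ k = nambuDenCT L M β μ h 0 k := by
  rw [nambuDenCT, nambuDenCT, nambuXiCT_smul_coeff, zero_mul, sub_zero, nambuXiCT_zero_frame]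

/-- **The flow of one free mode**: `d/dt log den_{K_t}(k) = −2 K(p) e_{K_t}(k) / den_{K_t}(k)` (`β ≠ 0`). [folklore] -/
theorem hasDerivAt_log_nambuDenCT_smul_coeff (hβ : β ≠ 0) (t : ℝ) (k : FreqMomentum L M) :
    HasDerivAt (fun u : ℝ => Real.log (nambuDenCT L M β μ h ⟨K.degree, fun m n => u * K.coeff m n⟩ k))
      (-(2 * K.eval (latticeMomentum L k.2) * nambuXiCT L μ ⟨K.degree, fun m n => t * K.coeff m n⟩ k.2) /
        nambuDenCT L M β μ h ⟨K.degree, fun m n => t * K.coeff m n⟩ k) t := by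
  have h1 : HasDerivAt (fun u : ℝ => nambuXi L μ k.2 - u * K.eval (latticeMomentum L k.2))
      (-(K.eval (latticeMomentum L k.2))) t := by
    simpa using ((hasDerivAt_id t).mul_const (K.eval (latticeMomentum L k.2))).const_sub (nambuXi L μ k.2)
  have hd : HasDerivAt (fun u : ℝ => nambuDenCT L M β μ h ⟨K.degree, fun m n => u * K.coeff m n⟩ k)
      (2 * (nambuXi L μ k.2 - t * K.eval (latticeMomentum L k.2)) * -(K.eval (latticeMomentum L k.2))) t := by
    have h3 := ((h1.fun_pow 2).const_add (matsubaraFreq β M k.1 ^ 2)).add_const ((h * dWaveSymbol L k.2) ^ 2)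
    simp only [nambuDenCT_smul_coeff]
    exact h3.congr_deriv (by norm_num)
  have hne : nambuDenCT L M β μ h ⟨K.degree, fun m n => t * K.coeff m n⟩ k ≠ 0 := (nambuDenCT_pos L M hβ μ h _ k).ne'
  refine (hd.log hne).congr_deriv ?_
  rw [nambuXiCT_smul_coeff]
  ring

/-- **The flow of the free determinant ratio**: `Λ(t) = Σ_k 2(log den_0(k) − log den_{K_t}(k))` has
`Λ′(t) = Σ_k 4 K(p_k) e_{K_t}(k)/den_{K_t}(k)` (`β ≠ 0`). [folklore] -/
theorem hasDerivAt_sum_log_nambuDenCT [NeZero L] (hβ : β ≠ 0) (t : ℝ) :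
    HasDerivAt (fun u : ℝ => ∑ k : FreqMomentum L M,
        2 * (Real.log (nambuDenCT L M β μ h 0 k) - Real.log (nambuDenCT L M β μ h ⟨K.degree, fun m n => u * K.coeff m n⟩ k)))
      (∑ k : FreqMomentum L M,
        4 * (K.eval (latticeMomentum L k.2) * nambuXiCT L μ ⟨K.degree, fun m n => t * K.coeff m n⟩ k.2 /
          nambuDenCT L M β μ h ⟨K.degree, fun m n => t * K.coeff m n⟩ k)) t := by
  refine HasDerivAt.fun_sum fun k _ => ?_
  have h1 := ((hasDerivAt_log_nambuDenCT_smul_coeff (L := L) (M := M) β μ h K hβ t k).const_sub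
    (Real.log (nambuDenCT L M β μ h 0 k))).const_mul 2
  refine h1.congr_deriv ?_
  ring

end FreeModes

section Flow

variable {L M} [NeZero L] (β μ h : ℝ) (K : TrigPolyC4v) {S : Matrix (HubbardFieldIdx L M) (HubbardFieldIdx L M) ℂ}
  (hS : S = Matrix.of fun Z W : HubbardFieldIdx L M =>
    (if Z.2 = 0 ∧ W = (Z.1, 1) then -(((K.eval (latticeMomentum L Z.1.1.2) / (β * (L : ℝ) ^ 2) : ℝ) : ℂ)) else 0) -
    (if W.2 = 0 ∧ Z = (W.1, 1) then -(((K.eval (latticeMomentum L W.1.1.2) / (β * (L : ℝ) ^ 2) : ℝ) : ℂ)) else 0))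
include hS

/-- **The resolvent cocycle along the scaled frames** (`S = S_K` the counterterm matrix of `HubbardCovarianceFrameResolvent`,
`K_t = t·K`): `(1 − t C^0 S_K)(1 − s C^{K_t} S_K) = 1 − (t+s) C^0 S_K` (`β ≠ 0`) — the frame `K_{t+s}` is the frame `K_s` over
`K_t`. [folklore] -/
theorem one_sub_smul_mul_one_sub_smul (hβ : β ≠ 0) (t s : ℝ) :
    (1 - (t : ℂ) • (hubbardCovarianceCT L M β μ h 0 * S)) *
        (1 - (s : ℂ) • (hubbardCovarianceCT L M β μ h ⟨K.degree, fun m n => t * K.coeff m n⟩ * S)) =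
      1 - ((t + s : ℝ) : ℂ) • (hubbardCovarianceCT L M β μ h 0 * S) := by
  subst hS
  have hres : (1 - (t : ℂ) • (hubbardCovarianceCT L M β μ h 0 *
      Matrix.of fun Z W : HubbardFieldIdx L M =>
        (if Z.2 = 0 ∧ W = (Z.1, 1) then -(((K.eval (latticeMomentum L Z.1.1.2) / (β * (L : ℝ) ^ 2) : ℝ) : ℂ)) else 0) -
        (if W.2 = 0 ∧ Z = (W.1, 1) then -(((K.eval (latticeMomentum L W.1.1.2) / (β * (L : ℝ) ^ 2) : ℝ) : ℂ)) else 0))) *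
      hubbardCovarianceCT L M β μ h ⟨K.degree, fun m n => t * K.coeff m n⟩ = hubbardCovarianceCT L M β μ h 0 := by
    have h1 := counterResolvent_mul_hubbardCovarianceCT L M μ h (⟨K.degree, fun m n => t * K.coeff m n⟩ : TrigPolyC4v) hβ
    rw [← hubbardCovarianceCT_zero_frame L M β μ h, counterMatrix_smul_coeff L M β K t, Matrix.mul_smul] at h1
    exact h1
  rw [Matrix.mul_sub, Matrix.mul_one, Matrix.mul_smul, ← Matrix.mul_assoc, hres, Complex.ofReal_add, add_smul]
  abel

/-- **The determinant cocycle**: `det(1 − u C^0 S_K) = det(1 − t C^0 S_K) · det(1 − (u−t) C^{K_t} S_K)` (`β ≠ 0`). [folklore] -/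
theorem det_one_sub_smul_eq_mul (hβ : β ≠ 0) (t u : ℝ) :
    (1 - (u : ℂ) • (hubbardCovarianceCT L M β μ h 0 * S)).det =
      (1 - (t : ℂ) • (hubbardCovarianceCT L M β μ h 0 * S)).det *
        (1 - ((u - t : ℝ) : ℂ) • (hubbardCovarianceCT L M β μ h ⟨K.degree, fun m n => t * K.coeff m n⟩ * S)).det := by
  rw [← Matrix.det_mul, one_sub_smul_mul_one_sub_smul β μ h K hS hβ t (u - t), add_sub_cancel]

/-- **The flow of the determinant**: `G(t) = det(1 − t C^0 S_K)` satisfies `G′(t) = −tr(C^{K_t} S_K) · G(t)` on `ℝ` (`β ≠ 0`;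
cocycle plus Jacobi at the identity). [folklore] -/
theorem hasDerivAt_det_one_sub_smul_frame (hβ : β ≠ 0) (t : ℝ) :
    HasDerivAt (fun u : ℝ => (1 - (u : ℂ) • (hubbardCovarianceCT L M β μ h 0 * S)).det)
      ((1 - (t : ℂ) • (hubbardCovarianceCT L M β μ h 0 * S)).det *
        -(hubbardCovarianceCT L M β μ h ⟨K.degree, fun m n => t * K.coeff m n⟩ * S).trace) t := by
  have hfun : (fun u : ℝ => (1 - (u : ℂ) • (hubbardCovarianceCT L M β μ h 0 * S)).det) = fun u : ℝ =>
      (1 - (t : ℂ) • (hubbardCovarianceCT L M β μ h 0 * S)).det *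
        (1 - ((u - t : ℝ) : ℂ) • (hubbardCovarianceCT L M β μ h ⟨K.degree, fun m n => t * K.coeff m n⟩ * S)).det :=
    funext fun u => det_one_sub_smul_eq_mul β μ h K hS hβ t u
  rw [hfun]
  refine HasDerivAt.const_mul _ ?_
  have hg : HasDerivAt (fun s : ℝ => (1 - (s : ℂ) • (hubbardCovarianceCT L M β μ h ⟨K.degree, fun m n => t * K.coeff m n⟩ * S)).det)
      (-(hubbardCovarianceCT L M β μ h ⟨K.degree, fun m n => t * K.coeff m n⟩ * S).trace) (t - t) := by
    rw [sub_self]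
    exact hasDerivAt_det_one_sub_ofReal_smul _
  exact hg.comp_sub_const t t

/-- The trace of the flow generator is real: `tr(C^{K_t} S_K) = ↑(Σ_k 4 K e_{K_t}/den_{K_t})` (`β ≠ 0`). [folklore] -/
theorem trace_smul_coeff_eq_ofReal (hβ : β ≠ 0) (t : ℝ) :
    (hubbardCovarianceCT L M β μ h ⟨K.degree, fun m n => t * K.coeff m n⟩ * S).trace =
      ((∑ k : FreqMomentum L M,
        4 * (K.eval (latticeMomentum L k.2) * nambuXiCT L μ ⟨K.degree, fun m n => t * K.coeff m n⟩ k.2 /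
          nambuDenCT L M β μ h ⟨K.degree, fun m n => t * K.coeff m n⟩ k) : ℝ) : ℂ) := by
  subst hS
  rw [trace_hubbardCovarianceCT_mul_counterMatrix μ h K (⟨K.degree, fun m n => t * K.coeff m n⟩ : TrigPolyC4v) hβ,
    Finset.mul_sum]
  push_cast
  rfl

/-- **Conservation law of the flow**: `det(1 − t C^0 S_K) · exp Σ_k 2(log den_0(k) − log den_{K_t}(k))` has zero derivative on `ℝ`
(`β ≠ 0`). [folklore] -/
theorem hasDerivAt_det_mul_exp_zero (hβ : β ≠ 0) (t : ℝ) :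
    HasDerivAt (fun u : ℝ => (1 - (u : ℂ) • (hubbardCovarianceCT L M β μ h 0 * S)).det *
        ((Real.exp (∑ k : FreqMomentum L M, 2 * (Real.log (nambuDenCT L M β μ h 0 k) -
          Real.log (nambuDenCT L M β μ h ⟨K.degree, fun m n => u * K.coeff m n⟩ k))) : ℝ) : ℂ)) 0 t := by
  have hG := hasDerivAt_det_one_sub_smul_frame β μ h K hS hβ t
  have hE := ((hasDerivAt_sum_log_nambuDenCT (L := L) (M := M) β μ h K hβ t).exp).ofReal_comp
  have hP := hG.fun_mul hE
  rw [trace_smul_coeff_eq_ofReal β μ h K hS hβ t] at hP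
  refine hP.congr_deriv ?_
  push_cast
  ring

/-- **The integrated flow**: `det(1 − t C^0 S_K) · exp Σ_k 2(log den_0(k) − log den_{K_t}(k)) = 1` for every `t` (`β ≠ 0`). [folklore] -/
theorem det_one_sub_smul_mul_exp (hβ : β ≠ 0) (t : ℝ) :
    (1 - (t : ℂ) • (hubbardCovarianceCT L M β μ h 0 * S)).det *
        ((Real.exp (∑ k : FreqMomentum L M, 2 * (Real.log (nambuDenCT L M β μ h 0 k) -
          Real.log (nambuDenCT L M β μ h ⟨K.degree, fun m n => t * K.coeff m n⟩ k))) : ℝ) : ℂ) = 1 := by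
  have hdiff : Differentiable ℝ (fun u : ℝ => (1 - (u : ℂ) • (hubbardCovarianceCT L M β μ h 0 * S)).det *
      ((Real.exp (∑ k : FreqMomentum L M, 2 * (Real.log (nambuDenCT L M β μ h 0 k) -
        Real.log (nambuDenCT L M β μ h ⟨K.degree, fun m n => u * K.coeff m n⟩ k))) : ℝ) : ℂ)) :=
    fun u => (hasDerivAt_det_mul_exp_zero β μ h K hS hβ u).differentiableAt
  have hderiv : ∀ u, deriv (fun u : ℝ => (1 - (u : ℂ) • (hubbardCovarianceCT L M β μ h 0 * S)).det *
      ((Real.exp (∑ k : FreqMomentum L M, 2 * (Real.log (nambuDenCT L M β μ h 0 k) -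
        Real.log (nambuDenCT L M β μ h ⟨K.degree, fun m n => u * K.coeff m n⟩ k))) : ℝ) : ℂ)) u = 0 :=
    fun u => (hasDerivAt_det_mul_exp_zero β μ h K hS hβ u).deriv
  have hΦ0 : (1 - ((0 : ℝ) : ℂ) • (hubbardCovarianceCT L M β μ h 0 * S)).det *
      ((Real.exp (∑ k : FreqMomentum L M, 2 * (Real.log (nambuDenCT L M β μ h 0 k) -
        Real.log (nambuDenCT L M β μ h ⟨K.degree, fun m n => (0 : ℝ) * K.coeff m n⟩ k))) : ℝ) : ℂ) = 1 := by
    rw [Complex.ofReal_zero, zero_smul, sub_zero, Matrix.det_one, one_mul,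
      Finset.sum_eq_zero fun k _ => by rw [nambuDenCT_smul_coeff_zero, sub_self, mul_zero], Real.exp_zero, Complex.ofReal_one]
  exact (is_const_of_deriv_eq_zero hdiff hderiv t 0).trans hΦ0

/-- The determinant of the frame, abstract form (`S = S_K`): `det(1 − C^0 S) = Π_k (den_K(k)/den_0(k))²` (`β ≠ 0`). [folklore] -/
theorem det_one_sub_mul_eq_prod (hβ : β ≠ 0) :
    (1 - hubbardCovarianceCT L M β μ h 0 * S).det =
      ((∏ k : FreqMomentum L M, (nambuDenCT L M β μ h K k / nambuDenCT L M β μ h 0 k) ^ 2 : ℝ) : ℂ) := by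
  have h1 := det_one_sub_smul_mul_exp β μ h K hS hβ 1
  rw [Complex.ofReal_one, one_smul, TrigPolyC4v.smul_coeff_one] at h1
  have hpos0 : ∀ k : FreqMomentum L M, 0 < nambuDenCT L M β μ h 0 k := fun k => nambuDenCT_pos L M hβ μ h 0 k
  have hposK : ∀ k : FreqMomentum L M, 0 < nambuDenCT L M β μ h K k := fun k => nambuDenCT_pos L M hβ μ h K k
  have hexp : Real.exp (∑ k : FreqMomentum L M, 2 * (Real.log (nambuDenCT L M β μ h 0 k) - Real.log (nambuDenCT L M β μ h K k))) *
      ∏ k : FreqMomentum L M, (nambuDenCT L M β μ h K k / nambuDenCT L M β μ h 0 k) ^ 2 = 1 := by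
    rw [Real.exp_sum, ← Finset.prod_mul_distrib]
    refine Finset.prod_eq_one fun k _ => ?_
    rw [show (2 : ℝ) * (Real.log (nambuDenCT L M β μ h 0 k) - Real.log (nambuDenCT L M β μ h K k)) =
        (Real.log (nambuDenCT L M β μ h 0 k) - Real.log (nambuDenCT L M β μ h K k)) +
          (Real.log (nambuDenCT L M β μ h 0 k) - Real.log (nambuDenCT L M β μ h K k)) by ring,
      Real.exp_add, Real.exp_sub, Real.exp_log (hpos0 k), Real.exp_log (hposK k)]
    have ha := (hpos0 k).ne'
    have hb := (hposK k).ne'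
    field_simp
  calc (1 - hubbardCovarianceCT L M β μ h 0 * S).det
      = (1 - hubbardCovarianceCT L M β μ h 0 * S).det *
          ((Real.exp (∑ k : FreqMomentum L M,
              2 * (Real.log (nambuDenCT L M β μ h 0 k) - Real.log (nambuDenCT L M β μ h K k))) *
            ∏ k : FreqMomentum L M, (nambuDenCT L M β μ h K k / nambuDenCT L M β μ h 0 k) ^ 2 : ℝ) : ℂ) := by
        rw [hexp, Complex.ofReal_one, mul_one]
    _ = (1 - hubbardCovarianceCT L M β μ h 0 * S).det *
          ((Real.exp (∑ k : FreqMomentum L M,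
            2 * (Real.log (nambuDenCT L M β μ h 0 k) - Real.log (nambuDenCT L M β μ h K k))) : ℝ) : ℂ) *
          ((∏ k : FreqMomentum L M, (nambuDenCT L M β μ h K k / nambuDenCT L M β μ h 0 k) ^ 2 : ℝ) : ℂ) := by
        rw [Complex.ofReal_mul, mul_assoc]
    _ = ((∏ k : FreqMomentum L M, (nambuDenCT L M β μ h K k / nambuDenCT L M β μ h 0 k) ^ 2 : ℝ) : ℂ) := by
        rw [h1, one_mul]

omit hS in
/-- **The determinant of the frame**: `det(1 − C^0 S_K) = Π_k (den_K(k)/den_0(k))²` for every frame `K`, every `μ, h`, `β ≠ 0`,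
at finite `(L, M)`, with `S_K = N_K − N_Kᵀ` the counterterm matrix of `HubbardCovarianceFrameResolvent` — so the Gaussian
normalisation `Z_K = ∫ dμ_{C^K} e^{−𝒩_K}` has `Z_K² = Π_k (den_0/den_K)²`. [folklore] -/
theorem det_one_sub_counterMatrix_eq_prod (hβ : β ≠ 0) :
    (1 - hubbardCovarianceCT L M β μ h 0 *
        Matrix.of fun Z W : HubbardFieldIdx L M =>
          (if Z.2 = 0 ∧ W = (Z.1, 1) then -(((K.eval (latticeMomentum L Z.1.1.2) / (β * (L : ℝ) ^ 2) : ℝ) : ℂ)) else 0) -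
          (if W.2 = 0 ∧ Z = (W.1, 1) then -(((K.eval (latticeMomentum L W.1.1.2) / (β * (L : ℝ) ^ 2) : ℝ) : ℂ)) else 0)).det =
      ((∏ k : FreqMomentum L M, (nambuDenCT L M β μ h K k / nambuDenCT L M β μ h 0 k) ^ 2 : ℝ) : ℂ) :=
  det_one_sub_mul_eq_prod β μ h K rfl hβ

end Flow

/-! ### §4 The normalisation of the frame and the free determinant cancel -/

section Normalisation

variable {L M} [NeZero L] (β μ h : ℝ) (K : TrigPolyC4v)

/-- **The Gaussian normalisation of the frame in closed form**: `‖∫ dμ_{C^K} e^{−𝒩_K}‖ = Π_k den_0(k)/den_K(k) = N^0/N^K`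
(`β ≠ 0`; from `Z_K² · det(1 − C^0 S_K) = 1` and `det_one_sub_counterMatrix_eq_prod`). [folklore] -/
theorem norm_gaussExpect_counterQuadratic (hβ : β ≠ 0) :
    ‖gaussExpect ℂ (hubbardCovarianceCT L M β μ h K) (grassmannExp (-counterQuadratic L M β K))‖ =
      ∏ k : FreqMomentum L M, nambuDenCT L M β μ h 0 k / nambuDenCT L M β μ h K k := by
  set Z := gaussExpect ℂ (hubbardCovarianceCT L M β μ h K) (grassmannExp (-counterQuadratic L M β K))
  have hpos0 : ∀ k : FreqMomentum L M, 0 < nambuDenCT L M β μ h 0 k := fun k => nambuDenCT_pos L M hβ μ h 0 k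
  have hposK : ∀ k : FreqMomentum L M, 0 < nambuDenCT L M β μ h K k := fun k => nambuDenCT_pos L M hβ μ h K k
  have hQ : 0 < ∏ k : FreqMomentum L M, nambuDenCT L M β μ h K k / nambuDenCT L M β μ h 0 k :=
    Finset.prod_pos fun k _ => div_pos (hposK k) (hpos0 k)
  have hdet := sq_gaussExpect_counterQuadratic_mul_det L M μ h K hβ
  rw [det_one_sub_counterMatrix_eq_prod β μ h K hβ, Finset.prod_pow] at hdet
  have hnorm : (‖Z‖ * ∏ k : FreqMomentum L M, nambuDenCT L M β μ h K k / nambuDenCT L M β μ h 0 k) ^ 2 = 1 := by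
    have h1 := congrArg norm hdet
    rw [norm_mul, norm_pow, Complex.norm_of_nonneg (pow_nonneg hQ.le 2), norm_one] at h1
    rw [mul_pow]
    exact h1
  have hone : ‖Z‖ * ∏ k : FreqMomentum L M, nambuDenCT L M β μ h K k / nambuDenCT L M β μ h 0 k = 1 :=
    (pow_eq_one_iff_of_nonneg (mul_nonneg (norm_nonneg _) hQ.le) two_ne_zero).1 hnorm
  calc ‖Z‖ = (∏ k : FreqMomentum L M, nambuDenCT L M β μ h K k / nambuDenCT L M β μ h 0 k)⁻¹ :=
        eq_inv_of_mul_eq_one_left hone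
    _ = ∏ k : FreqMomentum L M, nambuDenCT L M β μ h 0 k / nambuDenCT L M β μ h K k := by
        rw [← Finset.prod_inv_distrib]
        exact Finset.prod_congr rfl fun k _ => inv_div _ _

/-- In particular the normalisation of the frame never vanishes (`β ≠ 0`). [folklore] -/
theorem gaussExpect_counterQuadratic_ne_zero (hβ : β ≠ 0) :
    gaussExpect ℂ (hubbardCovarianceCT L M β μ h K) (grassmannExp (-counterQuadratic L M β K)) ≠ 0 := by
  rw [← norm_pos_iff, norm_gaussExpect_counterQuadratic β μ h K hβ]
  exact Finset.prod_pos fun k _ => div_pos (nambuDenCT_pos L M hβ μ h 0 k) (nambuDenCT_pos L M hβ μ h K k)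

/-- At zero twist the free log-determinant of the frame is `Σ_k log den_K(k) = log N^K` (`β ≠ 0`). [folklore] -/
theorem freeLogDetCT_zero_twist (hβ : β ≠ 0) :
    freeLogDetCT L M β μ h K 0 = ∑ k : FreqMomentum L M, Real.log (nambuDenCT L M β μ h K k) := by
  simp only [freeLogDetCT, deformedNambuDenCT_zero_twist]
  exact Finset.sum_congr rfl fun k _ => by rw [Complex.norm_of_nonneg (nambuDenCT_pos L M hβ μ h K k).le]

/-- **The free determinant of the frame and the Gaussian normalisation of its counterterm cancel exactly**:
`log N^K + log ‖∫ dμ_{C^K} e^{−𝒩_K}‖ = log N^0`, i.e. `freeLogDetCT … K 0 + log ‖Z_K‖ = freeLogDetCT … 0 0` (`β ≠ 0`, zero twist,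
every `μ, h`, finite `(L, M)`). [folklore] -/
theorem freeLogDetCT_add_log_norm_gaussExpect_counterQuadratic (hβ : β ≠ 0) :
    freeLogDetCT L M β μ h K 0 +
        Real.log ‖gaussExpect ℂ (hubbardCovarianceCT L M β μ h K) (grassmannExp (-counterQuadratic L M β K))‖ =
      freeLogDetCT L M β μ h 0 0 := by
  have hpos0 : ∀ k : FreqMomentum L M, 0 < nambuDenCT L M β μ h 0 k := fun k => nambuDenCT_pos L M hβ μ h 0 k
  have hposK : ∀ k : FreqMomentum L M, 0 < nambuDenCT L M β μ h K k := fun k => nambuDenCT_pos L M hβ μ h K k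
  rw [norm_gaussExpect_counterQuadratic β μ h K hβ, freeLogDetCT_zero_twist β μ h K hβ, freeLogDetCT_zero_twist β μ h 0 hβ,
    Real.log_prod fun k _ => (div_pos (hpos0 k) (hposK k)).ne', ← Finset.sum_add_distrib]
  refine Finset.sum_congr rfl fun k _ => ?_
  rw [Real.log_div (hpos0 k).ne' (hposK k).ne']
  ring

/-- **The fully integrated partition function read in the frame `K`**: `N^K · ‖∫ dμ_{C^K} e^{−V_K}‖ = N^0 · ‖∫ dμ_C e^{−V}‖` with
`N^K = Π_k den_K(k)`, `V_K = hubbardInteractionCT`, `V = hubbardInteraction` (`β ≠ 0`, zero twist, every `U, μ, h`, finite `(L, M)`)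
— "free determinant × normalised partition function" is the same number in every frame. [cite: FeldmanSalmhoferTrubowitz1996, §1–2] -/
theorem prod_nambuDenCT_mul_norm_effPartitionFn_hubbardInteractionCT (hβ : β ≠ 0) (U : ℝ) :
    (∏ k : FreqMomentum L M, nambuDenCT L M β μ h K k) *
        ‖effPartitionFn ℂ (hubbardCovarianceCT L M β μ h K) (hubbardInteractionCT L M β U K)‖ =
      (∏ k : FreqMomentum L M, nambuDenCT L M β μ h 0 k) *
        ‖effPartitionFn ℂ (hubbardCovariance L M β μ h) (hubbardInteraction L M β U)‖ := by
  rw [effPartitionFn_hubbardInteractionCT L M μ h K hβ U, norm_mul, norm_gaussExpect_counterQuadratic β μ h K hβ, ← mul_assoc,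
    ← Finset.prod_mul_distrib]
  congr 1
  exact Finset.prod_congr rfl fun k _ => mul_div_cancel₀ _ (nambuDenCT_pos L M hβ μ h K k).ne'

/-- The same in logarithmic form, `log N^K + log ‖Z^K_full‖ = log N^0 + log ‖Z^0_full‖`, wherever the bare partition function does
not vanish (`β ≠ 0`, zero twist): the quantity `freeLogDetCT + log ‖effPartitionFn‖` entering `mfFreeEnergyCT` is frame-independent
once the whole covariance is integrated. [cite: FeldmanSalmhoferTrubowitz1996, §1–2] -/
theorem freeLogDetCT_add_log_norm_effPartitionFn_hubbardInteractionCT (hβ : β ≠ 0) (U : ℝ)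
    (hZ : effPartitionFn ℂ (hubbardCovariance L M β μ h) (hubbardInteraction L M β U) ≠ 0) :
    freeLogDetCT L M β μ h K 0 +
        Real.log ‖effPartitionFn ℂ (hubbardCovarianceCT L M β μ h K) (hubbardInteractionCT L M β U K)‖ =
      freeLogDetCT L M β μ h 0 0 + Real.log ‖effPartitionFn ℂ (hubbardCovariance L M β μ h) (hubbardInteraction L M β U)‖ := by
  rw [effPartitionFn_hubbardInteractionCT L M μ h K hβ U, norm_mul,
    Real.log_mul (norm_ne_zero_iff.2 (gaussExpect_counterQuadratic_ne_zero β μ h K hβ)) (norm_ne_zero_iff.2 hZ), ← add_assoc,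
    freeLogDetCT_add_log_norm_gaussExpect_counterQuadratic β μ h K hβ]

end Normalisation

end Literature.MathematicalPhysics.QuantumLattice
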